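import Summits.QuantumFields.YangMills.Theorems.BalabanUVNodesN18AtRateRecord12Home
import Literature.MathematicalPhysics.QuantumFieldTheory.Balaban1983to89.Node00.RateRecordW1Reading

/-!
# BalabanUVNodes ∕ node N18 = NE5 — N18 AT THE NAMED W1 READING OF THE STAGE-12 RATE-RECORD HOME: `S_N18 (RRec₁₂ 𝔯_W1)` IN CLOSED
# FORM, `𝔯_W1 := RateReading₁₂.ofAssignment (Node00.W1.assignment₁₂ 𝔇) ne1` (Track A, DAG node N18 = `T4OutputRate.NE5 EA EB W κ θ C₅`
# :211; cluster K4 «SpineRates», item K3′ `SpineGivenEndpointR12`; module 8 of seat pub-ymgap-dag-n18-d, strategy s2 «by-name knit at the record»)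

HONEST FRAMING.  Count-neutral kernel bookkeeping (`--supports stmt-QuantumFields-19792`).  NE5 — the η-rate `C₅·θ₅^j·e^{−κ d_j(X)}` of the
one-step outputs as functionals of the background — is NOT PRINTED ([Balaban1987RG1] Thm 1 p. 259 states the flow, not a rate) and is NOT proved
here; N18 is NOT discharged.  What this file does: at the rate-record home of record, Stage 12 (layer A `Node00/RateRecord11` p455395, RR-2's key
`Node00/Record12DatumKey` p461524, layer B `Thm/BalabanUVNodesRateCarriersOfRecord12` — `u3OfRecord₁₂`, `RateReading₁₂`, `RRec₁₂`,
`s_N18_rRec₁₂_iff` — and this seat's module 7 `Thm/BalabanUVNodesN18AtRateRecord12Home`), it reads node N18's statement of record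
`S_N18 (RRec₁₂ 𝔯)` AT THE NAMED READING the definer landed (`Node00/RateRecordW1Reading` p465810: node U3's objects ARE W1's — level `k` compares
run A = `k` steps on the `k`-th torus `F.P k` with run B = `k + 1` steps on `F.P (k+1)`, run A's level functional IS `Re E^{(j)}(X; g; embA U)`, the
(2.13) history terms of the tower `S k` of one-step cluster data AS A DEFINITION (`Node00.W1.functionalC`), run B's first-coupling family IS
`Re E_B(pair (j, X); b∷g; embB U)` of `S (k+1)`, letters ONE block per construction), and proves:
* §0 (layer-B faces) `S_N18 (RRec₁₂ 𝔯)` READS ONLY node U3's objects `(𝔯.lit …).u3` (`s_N18_rRec₁₂_congr_u3`); for a proviso-free assignment the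
  provisos are forgotten (`s_N18_rRec₁₂_ofAssignment_iff`) and N14's dressed tower `ne1` is NOT read (`s_N18_rRec₁₂_ofAssignment_ne1_irrel`).
* §1 PER LEVEL, `Iff.rfl`: `N18At (u3OfRecord₁₂ θ (W1.assignment₁₂ 𝔇 F θ g₀ os).u3 k)` IS the displayed η-rate inequality for the (2.13) terms of
  `𝔇`'s towers (`n18At_u3OfRecord₁₂_w1_iff`), equivalently `N18At` at the LEVEL-PAIRING bundle `⟨(pairing k).carriers, ]0,θ.γ], θ.γ, κ, (pairing k).EA (S k),
  (pairing k).EB (S (k+1)), θ₅, C₅, …⟩` (`n18At_u3OfRecord₁₂_w1_iff_pairing` — the bundle equation at `k` dag-n22-e's module 3 uses).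
* §2 THE STATEMENT OF RECORD IN CLOSED FORM (`s_N18_rRec₁₂_w1_iff`): `S_N18 (RRec₁₂ 𝔯_W1)` ⇔ for every family `F`, every datum of record `D` with key
  `h : Node00.IsDatumOfRecord₁₂C F N D` (canonical Stage-12 parameter `θ := h.params`), every run length `k`, member `b ∈ ]0, θ.γ]`, history
  `g ∈ ]0, θ.γ]^ℕ`, run-B background `U` and run-A domain `(j, X)`:
  `|Re E_A^{(j)}(X; g; embA (transport U)) − Re E_B(pair (j, X); b∷g; embB U)| ≤ C₅ · θ₅ ^ j · e^{−κ·d_j(X)}` — `(g₀, os)` drop out (W1's U3 objects do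
  not read them); the θ-form sufficient condition over admissible tuples with provisos (`s_N18_rRec₁₂_w1_of_forall`) and the hand-back at a datum key
  (`w1Rate_of_s_N18_rRec₁₂`).
* §3 THE KNIT PER RUN LENGTH FROM ANY BUNDLE CARRYING `N18At` (`n18At_u3OfRecord₁₂_w1_of_comap_agree`, `…_of_comap_agree_letters`, `s_N18_rRec₁₂_w1_of_comap_agree`):
  maps of W1's level-`k` carriers (domains `(j, X)` of the `k`-th torus's catalogue, run-A ∕ run-B backgrounds) into the carriers of a U3 bundle `v` with
  `N18At v` — the H-layer END's bundle on `TwoRuns.carriers` (module 1 `n18At_of_envelopeOnRecord`, dag-n18-c's `N18AtWalkRecordsSized.n18At_of_termWalkData_sized`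
  with the constants exhibited), King's model bundle, … — preserving creation scale and tree length and commuting with the transports, AGREEMENT on
  `]0, θ.γ]^ℕ` of W1's (2.13) functionals with `v`'s read through the maps (run A at transported backgrounds, run B member by member), and the reading's
  letters dominating `v`'s ⇒ `N18At` at W1's level `k`; at every admissible tuple and level ⇒ `S_N18 (RRec₁₂ 𝔯_W1)` (`N18Knit.ne5_comap` + `ne5_mono`).
* §3b AT THE NAMED READING THE KNIT DOES NOT DEPEND ON THE TRANSPORT OF RECORD (`n18At_u3OfRecord₁₂_w1_of_transport_swap`; module 6, LENS card T1 (b)):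
  `N18At` at the level-pairing bundle through ANOTHER transport `T′` + run A's `LipBackground` bracket + the coherence letter `CU g j·gauge (T₀ U) (T′ U) ≤ D·θ₅^j`
  + `C₅′ + D = C₅` ⇒ N18 at W1's level `k` (W1's `LevelPairing` fixes `T₀` as data; the price of another identification is booked, not hidden).
* §4 THE ROW AT THE NAMED READING (`s_N18_rRec₁₂_w1_of_envelopeOnRecord`): «knit `T4OutputRate.NE5` from `EnvelopeOnRecord*` faces with the NODE-A majorant as
  hypothesis at `RRec`», now at ₁₂ and at `𝔯_W1`: per admissible tuple with provisos and run length `k`, a two-run datum `Rr` with per-member step models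
  representing (2.13) of activities carrying THE NODE-A MAJORANT `C₃ε₁·e^{−R_d·d}` near the admissible boxes ([II] Lemma 3 (2.38), instanced by nobody),
  the leaves L01–L03 ∕ L05–L09unit, the located numerals, [KP86]'s clause, the reach and sharp clauses (module 1's binder list VERBATIM), PLUS the §3 maps
  and agreement clauses identifying W1's (2.13) terms at level `k` with the END's functionals, and letter domination ⇒ `S_N18 (RRec₁₂ 𝔯_W1)` — module 4's
  `n18At_level_ofFixed_of_envelopeOnRecord` then §3, once per key and level.
* §5 HONESTY (`exists_w1_s_N18_rRec₁₂`): for W1's TERMLESS input datum (`Node00.W1.exists_assignmentInputs₁₂_populated_functionals_zero`: `EA k ≡ 0`,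
  `EB k b ≡ 0`) `S_N18 (RRec₁₂ 𝔯_W1)` holds OUTRIGHT for every `ne1` — so the statement at the named reading is content exactly for the `𝔇` whose towers
  ARE the (2.14) terms of the construction (N10's Lemmas 1–3 objects; LOCATED, definer ∕ NODE O lane), and a skeleton quoting it NAMES its `𝔇`; next to
  it there are readings over which it FAILS once a Stage-12 key is inhabited (module 7 `exists_not_s_N18_rRec₁₂_of_inhabited`).
What REMAINS for N18 (content, other rows): the §4 data for Bałaban's runs — the H-layer activity datum on the record's torus catalogue (dag-n18-c s1,
`…N18HLayerWalkRecordsSized` ∕ `…N18AtWalkRecordsSized`), NODE A's (2.38), NODE O's leaves, rows NE2 ∕ NE3's rates L07 ∕ L08 — and the identification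
clauses of §3 for `𝔇`'s towers; K0′ (a Stage-12 key inhabited).  One finite four-torus programme at fixed `ε`; NOT the continuum limit, NOT OS, NOT a
mass gap, NOT Clay.  0 `def`, 0 `sorry`.

Sources: T. Bałaban, CMP **109** (1987) [Balaban1987RG1] (0.8)–(0.10) p. 253, (0.24)–(0.25) p. 257, Thm 1 p. 259, (1.18) p. 263; CMP **116** (1988)
[Balaban1988RG2Cluster] (2.13)–(2.14) pp. 14–15, Lemma 3 (2.38) p. 20; CMP **122** (1989) [Balaban1989LargeFieldII] (2.13)–(2.14) p. 359; CMP **119**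
(1988) [Balaban1988Convergent] (2.27) p. 259.  Nothing here is a claim about the Yang–Mills mass gap.
-/

namespace YMDAG.N18.W1Reading

open Literature.MathematicalPhysics.QuantumFieldTheory.Balaban1983to89
open Literature.MathematicalPhysics.QuantumFieldTheory.Balaban1983to89.T4Continuum
open Literature.MathematicalPhysics.QuantumFieldTheory.Balaban1983to89.T4OutputRate (Carriers Functional NE5 LipBackground Window)
open Literature.MathematicalPhysics.QuantumFieldTheory.Balaban1983to89.T4InputCauchyRateData (StepModel)
open Literature.MathematicalPhysics.QuantumFieldTheory.Balaban1983to89.B13Resummation (locE)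
open Literature.MathematicalPhysics.QuantumFieldTheory.Balaban1983to89.TreeLengthTorus (TDom tsys torusTreeLen)
open Literature.MathematicalPhysics.QuantumFieldTheory.Balaban1983to89.TreeLengthTorusGeometry (TTouch)
open Literature.MathematicalPhysics.QuantumFieldTheory.Balaban1983to89.B12TreeDecay (K₀)
open Literature.MathematicalPhysics.QuantumFieldTheory.Balaban1983to89.Node00 (Stage12Params IsDatumOfRecord₁₂C U3Letters₁₁ U3Objects₁₁
  RateAssignment₁₂ prependCoupling)
open Summit.QuantumFields.BalabanUV.T4Continuum.B13Carriers (TwoRuns)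
open Summit.QuantumFields.BalabanUV.T4Continuum.Spine.NE5
open Summit.QuantumFields.YangMills.BalabanUVNodes.N18Knit (ne5_comap ne5_mono)
open YMDAG.N18.HLayer
open YMDAG.N18.TransportSwap (n18At_of_transport_swap)
open YMDAG.UVSplit

variable {N : ℕ} [NeZero N]

/-! ## §0 Layer-B faces: `S_N18` at the Stage-12 home reads only node U3's objects of the reading -/

/-- **`S_N18 (RRec₁₂ 𝔯)` READS ONLY NODE U3's OBJECTS OF THE READING** [bookkeeping]: two Stage-12 rate readings whose rate objects have the same U3
component at every tuple with provisos carry `S_N18` together (NE1′ ∕ NE2 ∕ NE3 components and the dressed tower are other nodes' carriers).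
[cite: Balaban1987RG1, Thm 1 p.259] -/
theorem s_N18_rRec₁₂_congr_u3 {𝔯 𝔯' : RateReading₁₂ N}
    (h : ∀ (F : T4Family) (θ : Stage12Params F N) (hP : θ.Provisos₁₂ F N) (g₀ : ℕ → ℝ) (os : List (ULoop F)),
      (𝔯'.lit F θ hP g₀ os).u3 = (𝔯.lit F θ hP g₀ os).u3) :
    S_N18 (RRec₁₂ 𝔯) ↔ S_N18 (RRec₁₂ 𝔯') := by
  rw [s_N18_rRec₁₂_iff, s_N18_rRec₁₂_iff]
  constructor
  · intro H F D hk g₀ os k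
    rw [h F hk.params hk.provisos g₀ os]
    exact H F D hk g₀ os k
  · intro H F D hk g₀ os k
    rw [← h F hk.params hk.provisos g₀ os]
    exact H F D hk g₀ os k

/-- **A PROVISO-FREE ASSIGNMENT FORGETS THE PROVISOS** [bookkeeping]: for `𝔯 := RateReading₁₂.ofAssignment a ne1` (RR-2's `RateAssignment₁₂`, W1's
`W1.assignment₁₂ 𝔇`), `S_N18 (RRec₁₂ 𝔯)` ⇔ `N18At` at every level of `a`'s U3 objects at the canonical parameter of every datum key.
[cite: Balaban1987RG1, Thm 1 p.259] -/
theorem s_N18_rRec₁₂_ofAssignment_iff (a : RateAssignment₁₂ N)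
    (ne1 : (F : T4Family) → Stage12Params F N → (ℕ → ℝ) → List (ULoop F) → NE1pCarriers) :
    S_N18 (RRec₁₂ (RateReading₁₂.ofAssignment a ne1)) ↔
      ∀ (F : T4Family) (D : Datum F N) (h : IsDatumOfRecord₁₂C F N D) (g₀ : ℕ → ℝ) (os : List (ULoop F)) (k : ℕ),
        N18At (u3OfRecord₁₂ h.params (a F h.params g₀ os).u3 k) :=
  s_N18_rRec₁₂_iff _

/-- **N14's DRESSED TOWER IS NOT READ** [bookkeeping]: `S_N18 (RRec₁₂ (ofAssignment a ne1))` does not depend on `ne1`. [cite: Balaban1987RG1, Thm 1 p.259] -/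
theorem s_N18_rRec₁₂_ofAssignment_ne1_irrel (a : RateAssignment₁₂ N)
    (ne1 ne1' : (F : T4Family) → Stage12Params F N → (ℕ → ℝ) → List (ULoop F) → NE1pCarriers) :
    S_N18 (RRec₁₂ (RateReading₁₂.ofAssignment a ne1)) ↔ S_N18 (RRec₁₂ (RateReading₁₂.ofAssignment a ne1')) :=
  s_N18_rRec₁₂_congr_u3 fun _ _ _ _ _ => rfl

/-! ## §1 Per level: N18 at the W1 reading's bundle of record, `Iff.rfl` -/

section Level

variable (𝔇 : Node00.W1.AssignmentInputs₁₂ N) (F : T4Family) (θ : Stage12Params F N) (g₀ : ℕ → ℝ) (os : List (ULoop F)) (k : ℕ)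

/-- **N18 AT THE W1 READING's LEVEL-`k` BUNDLE OF RECORD, IN W1's CURRENCY** (`Iff.rfl`; module 7 §6's display now AT THE NAMED READING): for every member
`b ∈ ]0, θ.γ]` of run B's first-coupling family, every history `g ∈ ]0, θ.γ]^ℕ`, every run-B background `U` and every run-A domain `(j, X)` of the `k`-th
torus's catalogue, `|Re E_A^{(j)}(X; g; embA (transport U)) − Re E_B(pair (j, X); b∷g; embB U)| ≤ C₅ · θ₅ ^ j · e^{−κ·d_j(X)}` — the (2.13) terms of the
towers `S k ∕ S (k+1)` of `𝔇`'s reading data, the pairing's maps, the reading's ONE letter block.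
[cite: Balaban1988RG2Cluster, (2.13) p.14; Balaban1987RG1, (0.24)–(0.25) p.257, (1.18) p.263 and Thm 1 p.259] -/
theorem n18At_u3OfRecord₁₂_w1_iff :
    N18At (u3OfRecord₁₂ θ (Node00.W1.assignment₁₂ 𝔇 F θ g₀ os).u3 k) ↔
      ∀ b : ℝ, 0 < b → b ≤ θ.γ → ∀ g ∈ Window θ.γ, ∀ (U : ((𝔇.w1 F θ).pairing k).BgB) (X : Node00.W1.Dom (F.P k) θ.τ9.M),
        |(Node00.W1.functionalC ((𝔇.w1 F θ).S k) g (((𝔇.w1 F θ).pairing k).embA (((𝔇.w1 F θ).pairing k).transport U)) X).re -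
            (Node00.W1.functionalC ((𝔇.w1 F θ).S (k + 1)) (prependCoupling b g) (((𝔇.w1 F θ).pairing k).embB U)
              (((𝔇.w1 F θ).pairing k).pair X)).re| ≤
          (𝔇.w1 F θ).li.C₅ * (𝔇.w1 F θ).li.θ₅ ^ X.1 * Real.exp (-((𝔇.w1 F θ).li.κ * (Node00.Sect2.domSys (F.P k) θ.τ9.M X.1).dj X.2)) :=
  Iff.rfl

/-- **THE SAME AT THE LEVEL-PAIRING BUNDLE** (`Iff.rfl`; the bundle equation at `k`): N18 at the W1 reading's level-`k` bundle of record IS `N18At` at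
`⟨(pairing k).carriers, ]0, θ.γ], θ.γ, κ, (pairing k).EA (S k), (pairing k).EB (S (k+1)), θ₅, C₅, moduli, C₉, ω, cr, ρ⟩` — the fixed-carrier bundle the
reading agrees with at level `k` (`Node00.W1.ReadingData.u3Objects_…_eq_ofFixed`). [cite: Balaban1987RG1, (0.24)–(0.25) p.257 and Thm 1 p.259] -/
theorem n18At_u3OfRecord₁₂_w1_iff_pairing :
    N18At (u3OfRecord₁₂ θ (Node00.W1.assignment₁₂ 𝔇 F θ g₀ os).u3 k) ↔
      N18At ⟨((𝔇.w1 F θ).pairing k).carriers, Window θ.γ, θ.γ, (𝔇.w1 F θ).li.κ, ((𝔇.w1 F θ).pairing k).EA ((𝔇.w1 F θ).S k),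
        ((𝔇.w1 F θ).pairing k).EB ((𝔇.w1 F θ).S (k + 1)), (𝔇.w1 F θ).li.θ₅, (𝔇.w1 F θ).li.C₅, ((𝔇.w1 F θ).li.analytic θ.γ).moduli,
        ((𝔇.w1 F θ).li.analytic θ.γ).C₉, ((𝔇.w1 F θ).li.analytic θ.γ).ω, (𝔇.w1 F θ).li.cr, (𝔇.w1 F θ).li.ρ⟩ :=
  Iff.rfl

end Level

/-! ## §2 The statement of record at the named reading, in closed form -/

section Record

variable (𝔇 : Node00.W1.AssignmentInputs₁₂ N) (ne1 : (F : T4Family) → Stage12Params F N → (ℕ → ℝ) → List (ULoop F) → NE1pCarriers)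

/-- **N18's STATEMENT OF RECORD AT THE NAMED W1 READING, IN CLOSED FORM** [bookkeeping]: `S_N18 (RRec₁₂ (ofAssignment (W1.assignment₁₂ 𝔇) ne1))` ⇔ for
every family `F`, every datum of record `D` with Stage-12 key `h` (canonical parameter `θ := h.params`, cube size `θ.τ9.M`, window radius `θ.γ`), every
run length `k`, member `b ∈ ]0, θ.γ]`, history `g ∈ ]0, θ.γ]^ℕ`, run-B background `U` and run-A domain `(j, X)`:
`|Re E_A^{(j)}(X; g; embA (transport U)) − Re E_B(pair (j, X); b∷g; embB U)| ≤ C₅ · θ₅ ^ j · e^{−κ·d_j(X)}` — the η-rate of the one-step outputs as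
functionals of the background for the (2.13) terms of `𝔇`'s towers.  The construction data `(g₀, os)` drop out: W1's U3 objects read only `(F, θ)`.
NOT PRINTED; NOT proved; content exactly for towers pinned to the (2.14) terms (§5). [cite: Balaban1987RG1, Thm 1 p.259 and (1.18) p.263; Balaban1988RG2Cluster, (2.13) p.14] -/
theorem s_N18_rRec₁₂_w1_iff :
    S_N18 (RRec₁₂ (RateReading₁₂.ofAssignment (Node00.W1.assignment₁₂ 𝔇) ne1)) ↔
      ∀ (F : T4Family) (D : Datum F N) (h : IsDatumOfRecord₁₂C F N D) (k : ℕ) (b : ℝ), 0 < b → b ≤ h.params.γ →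
        ∀ g ∈ Window h.params.γ, ∀ (U : ((𝔇.w1 F h.params).pairing k).BgB) (X : Node00.W1.Dom (F.P k) h.params.τ9.M),
          |(Node00.W1.functionalC ((𝔇.w1 F h.params).S k) g
                (((𝔇.w1 F h.params).pairing k).embA (((𝔇.w1 F h.params).pairing k).transport U)) X).re -
              (Node00.W1.functionalC ((𝔇.w1 F h.params).S (k + 1)) (prependCoupling b g) (((𝔇.w1 F h.params).pairing k).embB U)
                (((𝔇.w1 F h.params).pairing k).pair X)).re| ≤
            (𝔇.w1 F h.params).li.C₅ * (𝔇.w1 F h.params).li.θ₅ ^ X.1 *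
              Real.exp (-((𝔇.w1 F h.params).li.κ * (Node00.Sect2.domSys (F.P k) h.params.τ9.M X.1).dj X.2)) := by
  rw [s_N18_rRec₁₂_iff]
  exact ⟨fun H F D h k => H F D h (fun _ => 0) [] k, fun H F D h _ _ k => H F D h k⟩

/-- **THE θ-FORM SUFFICIENT CONDITION** [bookkeeping]: the displayed inequality at EVERY admissible Stage-12 tuple with provisos, every run length,
member, history, background and domain gives `S_N18` at the named reading (the datum key reads its objects at the canonical parameter, admissible with
provisos). [cite: Balaban1987RG1, Thm 1 p.259 and (1.18) p.263] -/
theorem s_N18_rRec₁₂_w1_of_forall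
    (h : ∀ (F : T4Family) (θ : Stage12Params F N), θ.Provisos₁₂ F N → θ.Admissible F N → ∀ (k : ℕ) (b : ℝ), 0 < b → b ≤ θ.γ →
      ∀ g ∈ Window θ.γ, ∀ (U : ((𝔇.w1 F θ).pairing k).BgB) (X : Node00.W1.Dom (F.P k) θ.τ9.M),
        |(Node00.W1.functionalC ((𝔇.w1 F θ).S k) g (((𝔇.w1 F θ).pairing k).embA (((𝔇.w1 F θ).pairing k).transport U)) X).re -
            (Node00.W1.functionalC ((𝔇.w1 F θ).S (k + 1)) (prependCoupling b g) (((𝔇.w1 F θ).pairing k).embB U)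
              (((𝔇.w1 F θ).pairing k).pair X)).re| ≤
          (𝔇.w1 F θ).li.C₅ * (𝔇.w1 F θ).li.θ₅ ^ X.1 * Real.exp (-((𝔇.w1 F θ).li.κ * (Node00.Sect2.domSys (F.P k) θ.τ9.M X.1).dj X.2))) :
    S_N18 (RRec₁₂ (RateReading₁₂.ofAssignment (Node00.W1.assignment₁₂ 𝔇) ne1)) :=
  s_N18_rRec₁₂_of_forall_admissible _ fun F θ hP hA _ _ k => h F θ hP hA k

/-- **WHAT `S_N18` AT THE NAMED READING HANDS BACK AT A DATUM KEY** [bookkeeping] (N17's knit, N19's rate edge, K4 read it so): the η-rate inequality for the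
(2.13) terms at the canonical parameter, every run length, member, history, background and domain. [cite: Balaban1987RG1, Thm 1 p.259 and (1.18) p.263] -/
theorem w1Rate_of_s_N18_rRec₁₂ (hS : S_N18 (RRec₁₂ (RateReading₁₂.ofAssignment (Node00.W1.assignment₁₂ 𝔇) ne1)))
    {F : T4Family} {D : Datum F N} (hk : IsDatumOfRecord₁₂C F N D) (k : ℕ) {b : ℝ} (hb : 0 < b) (hbγ : b ≤ hk.params.γ)
    {g : ℕ → ℝ} (hg : g ∈ Window hk.params.γ) (U : ((𝔇.w1 F hk.params).pairing k).BgB) (X : Node00.W1.Dom (F.P k) hk.params.τ9.M) :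
    |(Node00.W1.functionalC ((𝔇.w1 F hk.params).S k) g
          (((𝔇.w1 F hk.params).pairing k).embA (((𝔇.w1 F hk.params).pairing k).transport U)) X).re -
        (Node00.W1.functionalC ((𝔇.w1 F hk.params).S (k + 1)) (prependCoupling b g) (((𝔇.w1 F hk.params).pairing k).embB U)
          (((𝔇.w1 F hk.params).pairing k).pair X)).re| ≤
      (𝔇.w1 F hk.params).li.C₅ * (𝔇.w1 F hk.params).li.θ₅ ^ X.1 *
        Real.exp (-((𝔇.w1 F hk.params).li.κ * (Node00.Sect2.domSys (F.P k) hk.params.τ9.M X.1).dj X.2)) :=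
  (s_N18_rRec₁₂_w1_iff 𝔇 ne1).1 hS F D hk k b hb hbγ g hg U X

end Record

/-! ## §3 The knit per run length from any bundle carrying `N18At`: comap of W1's level carriers + window agreement -/

section Knit

variable (𝔇 : Node00.W1.AssignmentInputs₁₂ N) (F : T4Family) (θ : Stage12Params F N) (g₀ : ℕ → ℝ) (os : List (ULoop F)) (k : ℕ)

/-- **THE KNIT AT LEVEL `k`, LETTERS OF THE READING** [bookkeeping]: let `N18At` hold at a bundle `⟨C, W, γ′, κ, EA, EB, θ₅, C₅, …⟩` whose rate letters ARE the
reading's `κ, θ₅, C₅`, on a window `W ⊇ ]0, θ.γ]^ℕ` of radius `γ′ ≥ θ.γ`; let maps of W1's level-`k` carriers into `C` — domains `φD`, run-A backgrounds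
`φA`, run-B backgrounds `φB` — preserve the creation scale (`C.scale (φD (j, X)) = j`) and the tree length (`C.d (φD (j, X)) = d_j(X)`) and commute with the
transports (`φA (transport U) = C.transport (φB U)`); and let W1's (2.13) functionals AGREE on `]0, θ.γ]^ℕ` with `EA ∕ EB b` read through the maps — run A at
transported backgrounds, run B member by member `b ∈ ]0, θ.γ]`.  Then N18 holds at the W1 reading's level-`k` bundle of record (`N18Knit.ne5_comap`).
[cite: Balaban1987RG1, (0.24)–(0.25) p.257, (1.18) p.263 and Thm 1 p.259] -/
theorem n18At_u3OfRecord₁₂_w1_of_comap_agree_letters (C : Carriers) {W : Set (ℕ → ℝ)} {γ' : ℝ} (EA : Functional C C.BgA)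
    (EB : ℝ → Functional C C.BgB) {Λ : ℕ → ℕ → ℝ} {C₉ ωm cr ρ : ℝ}
    (hv : N18At ⟨C, W, γ', (𝔇.w1 F θ).li.κ, EA, EB, (𝔇.w1 F θ).li.θ₅, (𝔇.w1 F θ).li.C₅, Λ, C₉, ωm, cr, ρ⟩)
    (φD : Node00.W1.Dom (F.P k) θ.τ9.M → C.Dom) (φA : ((𝔇.w1 F θ).pairing k).BgA → C.BgA) (φB : ((𝔇.w1 F θ).pairing k).BgB → C.BgB)
    (hscale : ∀ X, C.scale (φD X) = X.1) (hd : ∀ X, C.d (φD X) = (Node00.Sect2.domSys (F.P k) θ.τ9.M X.1).dj X.2)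
    (htr : ∀ U, φA (((𝔇.w1 F θ).pairing k).transport U) = C.transport (φB U))
    (hA : ∀ g ∈ Window θ.γ, ∀ (U : ((𝔇.w1 F θ).pairing k).BgB) (X : Node00.W1.Dom (F.P k) θ.τ9.M),
      (Node00.W1.functionalC ((𝔇.w1 F θ).S k) g (((𝔇.w1 F θ).pairing k).embA (((𝔇.w1 F θ).pairing k).transport U)) X).re =
        EA g (φA (((𝔇.w1 F θ).pairing k).transport U)) (φD X))
    (hB : ∀ b : ℝ, 0 < b → b ≤ θ.γ → ∀ g ∈ Window θ.γ, ∀ (U : ((𝔇.w1 F θ).pairing k).BgB) (X : Node00.W1.Dom (F.P k) θ.τ9.M),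
      (Node00.W1.functionalC ((𝔇.w1 F θ).S (k + 1)) (prependCoupling b g) (((𝔇.w1 F θ).pairing k).embB U)
          (((𝔇.w1 F θ).pairing k).pair X)).re = EB b g (φB U) (φD X))
    (hW : Window θ.γ ⊆ W) (hγ : θ.γ ≤ γ') :
    N18At (u3OfRecord₁₂ θ (Node00.W1.assignment₁₂ 𝔇 F θ g₀ os).u3 k) := by
  rw [n18At_u3OfRecord₁₂_w1_iff]
  intro b hb hbγ g hg U X
  have h5 := ne5_comap (C' := Node00.W1.histCarriers (F.P k) θ.τ9.M ((𝔇.w1 F θ).pairing k).toRunPairing) φD φA φB hscale hd htr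
    (hv b hb (hbγ.trans hγ))
  rw [hA g hg U X, hB b hb hbγ g hg U X]
  exact h5 g (hW hg) U X

/-- **THE KNIT AT LEVEL `k` FROM ANY BUNDLE CARRYING `N18At`, LETTERS DOMINATED** [bookkeeping]: as `…_of_comap_agree_letters` for a U3 bundle `v` with
`N18At v` and ITS OWN letters — the H-layer END's bundle on `TwoRuns.carriers` (module 1 `n18At_of_envelopeOnRecord`; dag-n18-c's
`N18AtWalkRecordsSized.n18At_of_termWalkData_sized`, constants exhibited), King's model bundle, … — with the reading's letters DOMINATING `v`'s:
`]0, θ.γ]^ℕ ⊆ v.W`, `θ.γ ≤ v.γ`, `κ ≤ v.κ`, `0 ≤ v.θ ≤ θ₅`, `0 ≤ v.C₅ ≤ C₅` (`N18Knit.ne5_comap` + `ne5_mono`).  The maps and the two agreement clauses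
are the IDENTIFICATION of `𝔇`'s (2.13) terms at level `k` with the END's represented outputs — stated, not supplied.
[cite: Balaban1987RG1, (0.24)–(0.25) p.257, (1.18) p.263 and Thm 1 p.259] -/
theorem n18At_u3OfRecord₁₂_w1_of_comap_agree (v : U3Carriers) (hv : N18At v)
    (φD : Node00.W1.Dom (F.P k) θ.τ9.M → v.C.Dom) (φA : ((𝔇.w1 F θ).pairing k).BgA → v.C.BgA) (φB : ((𝔇.w1 F θ).pairing k).BgB → v.C.BgB)
    (hscale : ∀ X, v.C.scale (φD X) = X.1) (hd : ∀ X, v.C.d (φD X) = (Node00.Sect2.domSys (F.P k) θ.τ9.M X.1).dj X.2)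
    (htr : ∀ U, φA (((𝔇.w1 F θ).pairing k).transport U) = v.C.transport (φB U))
    (hA : ∀ g ∈ Window θ.γ, ∀ (U : ((𝔇.w1 F θ).pairing k).BgB) (X : Node00.W1.Dom (F.P k) θ.τ9.M),
      (Node00.W1.functionalC ((𝔇.w1 F θ).S k) g (((𝔇.w1 F θ).pairing k).embA (((𝔇.w1 F θ).pairing k).transport U)) X).re =
        v.EA g (φA (((𝔇.w1 F θ).pairing k).transport U)) (φD X))
    (hB : ∀ b : ℝ, 0 < b → b ≤ θ.γ → ∀ g ∈ Window θ.γ, ∀ (U : ((𝔇.w1 F θ).pairing k).BgB) (X : Node00.W1.Dom (F.P k) θ.τ9.M),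
      (Node00.W1.functionalC ((𝔇.w1 F θ).S (k + 1)) (prependCoupling b g) (((𝔇.w1 F θ).pairing k).embB U)
          (((𝔇.w1 F θ).pairing k).pair X)).re = v.EB b g (φB U) (φD X))
    (hW : Window θ.γ ⊆ v.W) (hγ : θ.γ ≤ v.γ) (hκ : (𝔇.w1 F θ).li.κ ≤ v.κ) (hθ0 : 0 ≤ v.θ) (hθ : v.θ ≤ (𝔇.w1 F θ).li.θ₅)
    (hC0 : 0 ≤ v.C₅) (hC : v.C₅ ≤ (𝔇.w1 F θ).li.C₅) :
    N18At (u3OfRecord₁₂ θ (Node00.W1.assignment₁₂ 𝔇 F θ g₀ os).u3 k) := by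
  rw [n18At_u3OfRecord₁₂_w1_iff]
  intro b hb hbγ g hg U X
  have h5 := ne5_mono (ne5_comap (C' := Node00.W1.histCarriers (F.P k) θ.τ9.M ((𝔇.w1 F θ).pairing k).toRunPairing) φD φA φB hscale hd
    htr (hv b hb (hbγ.trans hγ))) hW hκ hθ0 hθ hC0 hC
  rw [hA g hg U X, hB b hb hbγ g hg U X]
  exact h5 g hg U X

/-! ## §3b At the named reading the knit does not depend on the transport of record (module 6, LENS card T1 (b)) -/

/-- **AT THE NAMED READING N18 IS INSENSITIVE TO THE TRANSPORT OF RECORD, AT THE BOOKED PRICE** [bookkeeping]: W1's level pairing FIXES the one-step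
transport `T₀ := (pairing k).transport : BgB → BgA` as DATA (its docstring: the record intends the (0.8)–(0.10) block averaging).  If `N18At` holds at the
level-pairing bundle with run B's backgrounds read through ANOTHER transport `T′` (the structure-update literal `{ (pairing k).carriers with transport := T′ }` —
e.g. an END proved through the datum's block averaging, module 7 §8) with constant `C₅′`, and run A's (2.13) functional carries the background-Lipschitz bracket
`LipBackground` ([III] (2.27)(ii), displayed) with modulus `CU` on `]0, θ.γ]^ℕ`, and the COHERENCE LETTER `CU g j · gauge (T₀ U) (T′ U) ≤ D·θ₅^j` holds
(displayed; instances are printed-kind facts), and `C₅′ + D = C₅`, then N18 holds at the W1 reading's level-`k` bundle of record — module 6's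
`n18At_of_transport_swap` (one triangle inequality), read through §1's bundle equation. [cite: Balaban1987RG1, (0.8)–(0.10) p.253 and Thm 1 p.259; Balaban1988Convergent, (2.27)(ii) p.259] -/
theorem n18At_u3OfRecord₁₂_w1_of_transport_swap
    (T' : ((𝔇.w1 F θ).pairing k).BgB → ((𝔇.w1 F θ).pairing k).BgA) {CU : (ℕ → ℝ) → ℕ → ℝ} {C₅' D : ℝ} {Λ : ℕ → ℕ → ℝ} {C₉ ωm cr ρ : ℝ}
    (h : N18At ⟨{ ((𝔇.w1 F θ).pairing k).carriers with transport := T' }, Window θ.γ, θ.γ, (𝔇.w1 F θ).li.κ,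
      ((𝔇.w1 F θ).pairing k).EA ((𝔇.w1 F θ).S k), ((𝔇.w1 F θ).pairing k).EB ((𝔇.w1 F θ).S (k + 1)), (𝔇.w1 F θ).li.θ₅, C₅', Λ, C₉, ωm, cr, ρ⟩)
    (hU : LipBackground (((𝔇.w1 F θ).pairing k).EA ((𝔇.w1 F θ).S k)) (Window θ.γ) (𝔇.w1 F θ).li.κ CU)
    (hT : ∀ g ∈ Window θ.γ, ∀ (U : ((𝔇.w1 F θ).pairing k).BgB) (j : ℕ),
      CU g j * ((𝔇.w1 F θ).pairing k).gauge (((𝔇.w1 F θ).pairing k).transport U) (T' U) ≤ D * (𝔇.w1 F θ).li.θ₅ ^ j)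
    (hC : C₅' + D = (𝔇.w1 F θ).li.C₅) :
    N18At (u3OfRecord₁₂ θ (Node00.W1.assignment₁₂ 𝔇 F θ g₀ os).u3 k) := by
  rw [n18At_u3OfRecord₁₂_w1_iff_pairing, ← hC]
  exact fun b hb hbγ =>
    n18At_of_transport_swap (C := ((𝔇.w1 F θ).pairing k).carriers) (θ := (𝔇.w1 F θ).li.θ₅) (D := D) (CU := CU) T' h hU hT b hb hbγ

end Knit

/-- **`S_N18` AT THE NAMED READING FROM A BUNDLE CARRYING `N18At` PER ADMISSIBLE TUPLE AND RUN LENGTH** [bookkeeping]: the one application of §3 — at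
every admissible Stage-12 tuple with provisos and every run length `k`, a U3 bundle `v` with `N18At v`, the three maps with their compatibilities, the two
agreement clauses on `]0, θ.γ]^ℕ`, and letter domination.  For Bałaban's runs `v` is an END's bundle (§4; dag-n18-c's sized END); the clauses are
the identification of `𝔇`'s towers' (2.13) terms with its represented outputs. [cite: Balaban1987RG1, (0.24)–(0.25) p.257 and Thm 1 p.259] -/
theorem s_N18_rRec₁₂_w1_of_comap_agree (𝔇 : Node00.W1.AssignmentInputs₁₂ N)
    (ne1 : (F : T4Family) → Stage12Params F N → (ℕ → ℝ) → List (ULoop F) → NE1pCarriers)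
    (h : ∀ (F : T4Family) (θ : Stage12Params F N), θ.Provisos₁₂ F N → θ.Admissible F N → ∀ k : ℕ,
      ∃ (v : U3Carriers) (φD : Node00.W1.Dom (F.P k) θ.τ9.M → v.C.Dom) (φA : ((𝔇.w1 F θ).pairing k).BgA → v.C.BgA)
        (φB : ((𝔇.w1 F θ).pairing k).BgB → v.C.BgB),
        N18At v ∧ (∀ X, v.C.scale (φD X) = X.1) ∧ (∀ X, v.C.d (φD X) = (Node00.Sect2.domSys (F.P k) θ.τ9.M X.1).dj X.2) ∧
        (∀ U, φA (((𝔇.w1 F θ).pairing k).transport U) = v.C.transport (φB U)) ∧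
        (∀ g ∈ Window θ.γ, ∀ (U : ((𝔇.w1 F θ).pairing k).BgB) (X : Node00.W1.Dom (F.P k) θ.τ9.M),
          (Node00.W1.functionalC ((𝔇.w1 F θ).S k) g (((𝔇.w1 F θ).pairing k).embA (((𝔇.w1 F θ).pairing k).transport U)) X).re =
            v.EA g (φA (((𝔇.w1 F θ).pairing k).transport U)) (φD X)) ∧
        (∀ b : ℝ, 0 < b → b ≤ θ.γ → ∀ g ∈ Window θ.γ, ∀ (U : ((𝔇.w1 F θ).pairing k).BgB) (X : Node00.W1.Dom (F.P k) θ.τ9.M),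
          (Node00.W1.functionalC ((𝔇.w1 F θ).S (k + 1)) (prependCoupling b g) (((𝔇.w1 F θ).pairing k).embB U)
              (((𝔇.w1 F θ).pairing k).pair X)).re = v.EB b g (φB U) (φD X)) ∧
        Window θ.γ ⊆ v.W ∧ θ.γ ≤ v.γ ∧ (𝔇.w1 F θ).li.κ ≤ v.κ ∧ 0 ≤ v.θ ∧ v.θ ≤ (𝔇.w1 F θ).li.θ₅ ∧ 0 ≤ v.C₅ ∧
        v.C₅ ≤ (𝔇.w1 F θ).li.C₅) :
    S_N18 (RRec₁₂ (RateReading₁₂.ofAssignment (Node00.W1.assignment₁₂ 𝔇) ne1)) := by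
  refine s_N18_rRec₁₂_of_forall_admissible _ fun F θ hP hA g₀ os k => ?_
  obtain ⟨v, φD, φA, φB, hv, hscale, hd, htr, hAg, hBg, hW, hγ, hκ, hθ0, hθ, hC0, hC⟩ := h F θ hP hA k
  exact n18At_u3OfRecord₁₂_w1_of_comap_agree 𝔇 F θ g₀ os k v hv φD φA φB hscale hd htr hAg hBg hW hγ hκ hθ0 hθ hC0 hC

/-! ## §4 The row at the named reading: the H-layer END with the NODE-A majorant as hypothesis, per run length -/

open Classical in
/-- **THE H-LAYER END AT THE NAMED W1 READING, WITH THE NODE-A MAJORANT AS HYPOTHESIS** [bookkeeping] — the row «knit `T4OutputRate.NE5` from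
`EnvelopeOnRecord*` faces with the NODE-A majorant as hypothesis at `RRec`» at Stage 12 and at `𝔯_W1`: if at EVERY admissible Stage-12 tuple `θ` with
provisos and every run length `k` there are a two-run datum `Rr` (on any gauge group) with per-member step models `M b` (`b ∈ ]0, γ′]`, `γ′ ≥ θ.γ`) whose
outputs are (2.13) of activities `act b` (`hrep`), THE NODE-A MAJORANT AS HYPOTHESIS (near every admissible box an open set on which every activity is
ℂ-differentiable with `‖act b j z Z‖ ≤ C₃ε₁·e^{−R_d·d_j(Z)}` — [II] Lemma 3 (2.38), instanced by nobody), the END's run-A functional `EA` and run-B family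
`EB` with the leaves L01–L03, L05–L09unit, the located numerals, the [KP86] clause, the reach clause L10 and the sharp clause on a window `W ⊇ ]0, θ.γ]^ℕ`
(module 1's binder list VERBATIM), AND maps of W1's level-`k` carriers into `Rr.carriers` preserving creation scale and tree length and commuting with the
transports under which W1's (2.13) functionals of the towers `S k ∕ S (k+1)` AGREE on `]0, θ.γ]^ℕ` with `EA ∕ EB b` (§3's clauses), with the reading's
letters dominating the END's (`κ ≤ κ_END`, `θ′ ≤ θ₅`, `C₅(C₃ε₁) ≤ C₅`), then `S_N18 (RRec₁₂ 𝔯_W1)` — module 4's `n18At_level_ofFixed_of_envelopeOnRecord`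
(∘ module 1's `n18At_of_envelopeOnRecord` ∘ the END `EnvelopeOnRecord.ne5_of_leaves_fibre_activities_record_eps`) then §3, ONCE per key and level.  The
decidability instances of `locE` are the classical ones here. [cite: Balaban1988RG2Cluster, Lemma 3 (2.38) p.20 and (2.13) p.14; Balaban1987RG1, Thm 1 p.259] -/
theorem s_N18_rRec₁₂_w1_of_envelopeOnRecord (𝔇 : Node00.W1.AssignmentInputs₁₂ N)
    (ne1 : (F : T4Family) → Stage12Params F N → (ℕ → ℝ) → List (ULoop F) → NE1pCarriers)
    (h : ∀ (F : T4Family) (θ : Stage12Params F N), θ.Provisos₁₂ F N → θ.Admissible F N → ∀ k : ℕ,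
      ∃ (G : Type) (_ : GaugeGroup G) (Rr : TwoRuns G) (Op : Type) (_ : NormedAddCommGroup Op) (_ : NormedSpace ℂ Op)
        (Hist : Type) (_ : NormedAddCommGroup Hist) (_ : NormedSpace ℂ Hist) (M : ℝ → StepModel Rr.carriers Op Hist)
        (act : ℝ → (j : ℕ) → Op × Hist → TDom 4 (Rr.cubesPerDir j) → ℂ) (W : Set (ℕ → ℝ)) (γ' C3 ε₁ Rd κ : ℝ)
        (EA : Functional Rr.carriers Rr.carriers.BgA) (EB : ℝ → Functional Rr.carriers Rr.carriers.BgB)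
        (EA₀ E₀ E₁ δ δ' θr θ' cH ω ρ₀ B : ℝ) (k₀ : ℕ)
        (φD : Node00.W1.Dom (F.P k) θ.τ9.M → Rr.carriers.Dom) (φA : ((𝔇.w1 F θ).pairing k).BgA → Rr.carriers.BgA)
        (φB : ((𝔇.w1 F θ).pairing k).BgB → Rr.carriers.BgB),
        (∀ b : ℝ, 0 < b → b ≤ γ' → ∀ (X : Rr.carriers.Dom) (z : Op × Hist),
          (M b).Out X.1 z.1 z.2 X =
            locE (TTouch (d := 4) (N := Rr.cubesPerDir X.1)) (fun Z : (tsys 4 (Rr.cubesPerDir X.1)).Dom => Z.1) (act b X.1 z)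
              X.2.1) ∧
        0 ≤ C3 ∧ 0 ≤ ε₁ ∧ 0 ≤ κ ∧ κ + 2 * (64 * Real.log 162) + 2 ≤ Rd ∧
        C3 * ε₁ * Real.exp (5 * κ + 1) * K₀ 64 8 * 9 * 64 ≤ 1 ∧
        (∀ b : ℝ, 0 < b → b ≤ γ' → ∀ j, ∀ g ∈ W, ∀ (U : Rr.carriers.BgB) (p : Op × Hist), p ∈ (M b).Base j g U →
          ∃ V : Set (Op × Hist), IsOpen V ∧ (M b).box j p ⊆ V ∧
            (∀ Z : TDom 4 (Rr.cubesPerDir j), DifferentiableOn ℂ (fun z : Op × Hist => act b j z Z) V) ∧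
            (∀ z ∈ V, ∀ Z : TDom 4 (Rr.cubesPerDir j), ‖act b j z Z‖ ≤ C3 * ε₁ * Real.exp (-(Rd * torusTreeLen Z.1)))) ∧
        (∀ b : ℝ, 0 < b → b ≤ γ' → L01 (M b) EA W) ∧ (∀ b : ℝ, 0 < b → b ≤ γ' → L02 (M b) (EB b) W) ∧
        (∀ b : ℝ, 0 < b → b ≤ γ' → L03 (M b) (EB b) W) ∧ L05 EA W EA₀ κ ∧ (∀ b : ℝ, 0 < b → b ≤ γ' → L06 (EB b) W E₀ κ) ∧
        (∀ b : ℝ, 0 < b → b ≤ γ' → L07 (M b) W δ θr) ∧ (∀ b : ℝ, 0 < b → b ≤ γ' → L08 (M b) W κ E₀ δ' θr) ∧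
        (∀ b : ℝ, 0 < b → b ≤ γ' → L09aff (M b) W) ∧ (∀ b : ℝ, 0 < b → b ≤ γ' → L09blind (M b) W) ∧
        (∀ b : ℝ, 0 < b → b ≤ γ' → L09hom (M b) W) ∧ (∀ b : ℝ, 0 < b → b ≤ γ' → L09unit (M b) W κ E₁ cH ω) ∧
        0 < E₁ ∧ 0 ≤ δ + δ' ∧ 0 ≤ θr ∧ θr ≤ θ' ∧ θ' ≤ 1 ∧ 0 ≤ cH ∧ 0 < ω ∧ ρ₀ < 1 ∧
        (δ + δ') * θr ^ k₀ + cH * (EA₀ + E₀) / (1 - ω) ≤ ρ₀ ∧ 0 ≤ B ∧ (∀ k < k₀, EA₀ + E₀ ≤ B * θr ^ k) ∧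
        Real.exp 1 * 9 * 64 * K₀ 64 8 ^ 2 * C3 * cH * ε₁ < (θ' - ω) * (1 - ρ₀) ∧
        -- W1's level-`k` carriers map into the END's: scale, tree length, transports; the (2.13) terms agree with `EA ∕ EB b` on the window
        (∀ X, Rr.carriers.scale (φD X) = X.1) ∧ (∀ X, Rr.carriers.d (φD X) = (Node00.Sect2.domSys (F.P k) θ.τ9.M X.1).dj X.2) ∧
        (∀ U, φA (((𝔇.w1 F θ).pairing k).transport U) = Rr.carriers.transport (φB U)) ∧
        (∀ g ∈ Window θ.γ, ∀ (U : ((𝔇.w1 F θ).pairing k).BgB) (X : Node00.W1.Dom (F.P k) θ.τ9.M),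
          (Node00.W1.functionalC ((𝔇.w1 F θ).S k) g (((𝔇.w1 F θ).pairing k).embA (((𝔇.w1 F θ).pairing k).transport U)) X).re =
            EA g (φA (((𝔇.w1 F θ).pairing k).transport U)) (φD X)) ∧
        (∀ b : ℝ, 0 < b → b ≤ θ.γ → ∀ g ∈ Window θ.γ, ∀ (U : ((𝔇.w1 F θ).pairing k).BgB) (X : Node00.W1.Dom (F.P k) θ.τ9.M),
          (Node00.W1.functionalC ((𝔇.w1 F θ).S (k + 1)) (prependCoupling b g) (((𝔇.w1 F θ).pairing k).embB U)
              (((𝔇.w1 F θ).pairing k).pair X)).re = EB b g (φB U) (φD X)) ∧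
        -- the reading's letters dominate the END's
        Window θ.γ ⊆ W ∧ θ.γ ≤ γ' ∧ (𝔇.w1 F θ).li.κ ≤ κ ∧ θ' ≤ (𝔇.w1 F θ).li.θ₅ ∧
        (Real.exp 1 * 9 * 64 * K₀ 64 8 ^ 2 * (C3 * ε₁) / (1 - ρ₀) * (δ + δ') + B) * (θ' - ω) /
            (θ' - (ω + Real.exp 1 * 9 * 64 * K₀ 64 8 ^ 2 * (C3 * ε₁) / (1 - ρ₀) * cH)) ≤ (𝔇.w1 F θ).li.C₅) :
    S_N18 (RRec₁₂ (RateReading₁₂.ofAssignment (Node00.W1.assignment₁₂ 𝔇) ne1)) := by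
  refine s_N18_rRec₁₂_of_forall_admissible _ fun F θ hP hA g₀ os k => ?_
  obtain ⟨G, _, Rr, Op, _, _, Hist, _, _, M, act, W, γ', C3, ε₁, Rd, κ, EA, EB, EA₀, E₀, E₁, δ, δ', θr, θ', cH, ω, ρ₀, B, k₀, φD, φA,
    φB, hrep, hC3, hε₁, hκ, hrate, hKP, hH, l01, l02, l03, l05, l06, l07, l08, l09aff, l09blind, l09hom, l09unit, hE₁, hδ, hθ, hθθ', hθ'1,
    hcH, hω, hρ₀, l10near, hB, l10first, hS, hscale, hd, htr, hAg, hBg, hW, hγ, hℓκ, hℓθ, hℓC⟩ := h F θ hP hA k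
  -- module 4: the END at every level of the fixed-carrier bundle on `Rr.carriers` with the READING's letter block, on `]0, θ.γ]`
  have h4 := n18At_level_ofFixed_of_envelopeOnRecord Rr M hrep hC3 hε₁ hκ hrate hKP hH l01 l02 l03 l05 l06 l07 l08 l09aff l09blind l09hom
    l09unit hE₁ hδ hθ hθθ' hθ'1 hcH hω hρ₀ l10near hB l10first hS ((𝔇.w1 F θ).li.analytic θ.γ) hW hγ hℓκ hℓθ hℓC 0
  rw [n18At_level_ofFixed_iff] at h4
  exact n18At_u3OfRecord₁₂_w1_of_comap_agree_letters 𝔇 F θ g₀ os k Rr.carriers EA EB h4 φD φA φB hscale hd htr hAg hBg subset_rfl le_rfl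

/-! ## §5 Honesty: the termless datum satisfies the statement outright — the statement names its `𝔇` -/

/-- **INHABITATION IS NOT CONTENT, AT THE NAMED READING** [honesty]: there is a W1 input datum — the TERMLESS towers of
`Node00.W1.exists_assignmentInputs₁₂_populated_functionals_zero` (`EA k ≡ 0`, `EB k b ≡ 0`, populated U3 layer) — for which `S_N18 (RRec₁₂ (ofAssignment
(W1.assignment₁₂ 𝔇) ne1))` holds OUTRIGHT, for every dressed-tower assignment `ne1`, with nothing of Bałaban's proved.  So N18's statement of record at the
named reading is content exactly for the `𝔇` whose towers ARE the (2.14) terms of the construction (LOCATED: definer ∕ NODE O lane), and a skeleton quoting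
it NAMES its `𝔇`; module 7's `exists_not_s_N18_rRec₁₂_of_inhabited` shows it is refutable next door once a Stage-12 key is inhabited. [folklore] -/
theorem exists_w1_s_N18_rRec₁₂ :
    ∃ 𝔇 : Node00.W1.AssignmentInputs₁₂ N,
      ∀ ne1 : (F : T4Family) → Stage12Params F N → (ℕ → ℝ) → List (ULoop F) → NE1pCarriers,
        S_N18 (RRec₁₂ (RateReading₁₂.ofAssignment (Node00.W1.assignment₁₂ 𝔇) ne1)) := by
  obtain ⟨𝔇, h𝔇⟩ := Node00.W1.exists_assignmentInputs₁₂_populated_functionals_zero N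
  refine ⟨𝔇, fun ne1 => s_N18_rRec₁₂_of_forall_admissible _ fun F θ _ _ g₀ os k => ?_⟩
  obtain ⟨-, -, -, h5, -⟩ := h𝔇 F θ g₀ os k
  exact fun b _ _ => h5 b (Window θ.γ)

end YMDAG.N18.W1Reading
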